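import Summits.ResolutionOfSingularities.ResolutionOfSingularities.Theorems.MarkedTransferCampaignW46ThreefoldsTauTwoSlice
import Literature.AlgebraicGeometry.Resolution.NearPointsSigmaLocal
import Literature.AlgebraicGeometry.Resolution.NearPointsCurveCentre
import Literature.AlgebraicGeometry.Resolution.RegularBlowup
import HarnessLib

/-!
# [OURS · L1 W4.6 rung (ii-τ2)] THE CURVE SLICE WITH HYPOTHESES AT CLOSED POINTS ONLY — an equimultiple regular curve carrying
# the order-`m` locus, with `τ ≥ 2` at its CLOSED points, is order-reduced by one blowing up (quasi-compact `X`), PROVED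

Cell res-hironaka, LADDER-RESOLUTION rung L (D-0089), slot W4.6, rung (ii) (threefold hypersurfaces); seat res-L1-s46-pv-3
(gen 4). Host route MarkedTransfer, host item `HypersurfaceOrderReductionDimLeThree` (stmt-ResolutionOfSingularities-16156);
filed `--kind proof --supports` it `--as helper`. Hygiene upgrade of the campaign's curve slice (`orderReducible_of_curve_two_le_tau`,
p510009, and its form relative to an open, p517124), which asked for the codimension-`2` regular-parameter description and
`τ ≥ 2` at EVERY point of the curve, generic point included. Cossart–Piltant only ever test closed points: a near point over
ANY point of the centre specializes — the blowing up being a closed map — to a near point over a CLOSED point of the centre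
(orders do not decrease under specialization; every point of a quasi-compact scheme specializes to a closed point). So the
hypotheses are needed at closed points only, once `X` is quasi-compact. OURS scheme theory over PROVED tree lemmas; nothing of
H. Hironaka's manuscript is asserted. AI-written; AI review is weaker than expert review.

## What is proved (no definitions)

* `CampaignW46.exists_specializes_isClosed` — in a quasi-compact scheme every point specializes to a closed point.
* `CampaignW46.IsBlowup.idealOrder_lt_of_curve_closedPoints` — for the blowing up of a regular curve `Y` with `ord = m` along
  it and, at its CLOSED points, a codimension-`2` regular-parameter description and `τ ≥ 2`: EVERY point of `X′` over `Y` has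
  `ord J′ < m` (`X` quasi-compact).
* `CampaignW46.orderReducible_of_curve_two_le_tau_closedPoints` — the curve slice with closed-point hypotheses.
* `CampaignW46.orderReducible_comap_of_curve_two_le_tau_closedPoints` — the same relative to an open `V` (for patching).

References: `…ThreefoldsNoNearPointSlice.lean` (p510009), `…ThreefoldsTauTwoLocusSlice.lean` (p517124), `…ThreefoldsTauTwoSlice.lean`
(p515229: `OrderReducible.comap_opens_of_seq`); tree `Resolution/NearPointsCurveCentre.lean` (`IsBlowup.not_isNear_of_two_le_stalkTau`
[CossartPiltant2008, Lemma 4.3 (2)]), `Resolution/NearPointsSigmaLocal.lean` (p518139), `Resolution/OrderSemicontinuityPointwise.lean`,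
Mathlib `IsClosed.exists_closed_singleton`. H. Hironaka, ms. 2017-03-23 — scope only, under adjudication, not cited as fact. [Hironaka2017]
-/

noncomputable section

set_option linter.dupNamespace false -- mandated namespace of this single-conjunct summit

open CategoryTheory AlgebraicGeometry TopologicalSpace IsLocalRing

namespace Summit.ResolutionOfSingularities.ResolutionOfSingularities.Theorems

namespace CampaignW46

open Literature.AlgebraicGeometry.Resolution
open Scheme.IdealSheafData

universe u

variable {X : Scheme.{u}}

/-! ## §0 Closed specializations in a quasi-compact scheme -/

/-- **In a quasi-compact scheme every point specializes to a closed point** (a minimal non-empty closed subset of the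
closure is a closed singleton, the underlying space being `T₀`). [folklore] -/
theorem exists_specializes_isClosed [CompactSpace X] (x : X) : ∃ y : X, x ⤳ y ∧ IsClosed ({y} : Set X) := by
  obtain ⟨y, hy, hyc⟩ := (isClosed_closure (s := ({x} : Set X))).exists_closed_singleton ⟨x, subset_closure rfl⟩
  exact ⟨y, specializes_iff_mem_closure.mpr hy, hyc⟩

/-! ## §1 No point of order `≥ m` over the curve -/

/-- **Over an equimultiple regular curve with `τ ≥ 2` at its closed points, the blowing up has order `< m` everywhere.**
`X` regular locally Noetherian and quasi-compact, `Y` a closed regular curve with `ord_y J = m` along it (`m ≥ 1`) and, at each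
CLOSED point `y ∈ Y`, `(𝓘_Y)_y` generated by a codimension-`2` part of a regular system of parameters and `τ_y(J, m) ≥ 2`;
`π` the blowing up along `Y`. Then `ord_{x′} J′ < m` for every `x′ ∈ X′` over `Y`: otherwise `x′` is near, and specializes to a
near point over a closed point of `Y` (p518139 `IsBlowup.exists_isNear_of_specializes` with a closed specialization of `x′`),
which Cossart–Piltant 2008 Lemma 4.3 (2) forbids. [cite: CossartPiltant2008, Lemma 4.3 (2)] -/
theorem IsBlowup.idealOrder_lt_of_curve_closedPoints [IsLocallyNoetherian X] [CompactSpace X] (hX : Scheme.IsRegular X)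
    (J : X.IdealSheafData) {m : ℕ} (hm : 1 ≤ m) (Y : Closeds X) (hreg : Scheme.IsRegular (vanishingIdeal Y).subscheme)
    (hord : ∀ y ∈ (Y : Set X), idealOrder J y = m)
    (hcurve : ∀ y ∈ (Y : Set X), IsClosed ({y} : Set X) → haveI := hX y; ∃ c : Fin 2 → X.presheaf.stalk y,
      IsRsopPart c ∧ Ideal.span (Set.range c) = stalkIdeal (vanishingIdeal Y) y ∧ 2 ≤ stalkTau J y m)
    {X' : Scheme.{u}} {π : X' ⟶ X} (hπ : IsBlowup π (vanishingIdeal Y)) {x' : X'}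
    (hx : π x' ∈ (Y : Set X)) : idealOrder (controlledTransform π (vanishingIdeal Y) J m) x' < m := by
  haveI : IsProper π := hπ.isProper
  haveI : IsLocallyNoetherian X' := LocallyOfFiniteType.isLocallyNoetherian π
  haveI : CompactSpace X' := QuasiCompact.compactSpace_of_compactSpace π
  have hX' : Scheme.IsRegular X' := hπ.isRegular_of_isRegular_subscheme hX hreg
  by_contra hge
  rw [not_lt] at hge
  -- a closed specialization of `x'`, which lies over a closed point of `Y` and is near
  obtain ⟨x'', hsp, hcl''⟩ := exists_specializes_isClosed x'
  haveI : IsRegularLocalRing (X'.presheaf.stalk x'') := hX' x''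
  have hge'' : (m : ℕ∞) ≤ idealOrder (controlledTransform π (vanishingIdeal Y) J m) x'' :=
    hge.trans (idealOrder_le_of_specializes hsp _)
  have hπsp : π x' ⤳ π x'' := hsp.map π.continuous
  have hx'' : π x'' ∈ (Y : Set X) := hπsp.mem_closed Y.2 hx
  have hcl : IsClosed ({π x''} : Set X) := by
    have h := π.isClosedMap _ hcl''
    rwa [Set.image_singleton] at h
  obtain ⟨z, hzsp, hz, hnear⟩ := hπ.exists_isNear_of_specializes hX hX' hreg hord hx'' (specializes_refl _) hge''
  -- `z` is near over the closed point `π x''` of `Y`: impossible at `τ ≥ 2` over a curve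
  haveI : IsRegularLocalRing (X.presheaf.stalk (π z)) := hX (π z)
  obtain ⟨c, hcr, hcY, hτ⟩ := hcurve (π z) (by rw [hz]; exact hx'') (by rw [hz]; exact hcl)
  exact hπ.not_isNear_of_two_le_stalkTau hX hreg hm hord hcr hcY hτ hnear

/-! ## §2 The curve slice, closed-point hypotheses -/

/-- **THE CURVE SLICE, CLOSED-POINT FORM.** `X` regular locally Noetherian and quasi-compact, `J`, `m ≥ 1`, `Y` a closed regular
curve carrying every point of order `≥ m`, with `ord = m` along it and, at its CLOSED points, a codimension-`2` regular-parameter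
description and `τ ≥ 2`. Then `(X, J, m)` is order-reducible — by the one blowing up of `Y`.
[cite: CossartPiltant2008, Lemma 4.3 (2)] -/
theorem orderReducible_of_curve_two_le_tau_closedPoints [IsLocallyNoetherian X] [CompactSpace X]
    (hX : Scheme.IsRegular X) (J : X.IdealSheafData) {m : ℕ} (hm : 1 ≤ m) (Y : Closeds X)
    (hreg : Scheme.IsRegular (vanishingIdeal Y).subscheme)
    (hJY : ∀ x : X, (m : ℕ∞) ≤ idealOrder J x → x ∈ (Y : Set X)) (hord : ∀ y ∈ (Y : Set X), idealOrder J y = m)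
    (hcurve : ∀ y ∈ (Y : Set X), IsClosed ({y} : Set X) → haveI := hX y; ∃ c : Fin 2 → X.presheaf.stalk y,
      IsRsopPart c ∧ Ideal.span (Set.range c) = stalkIdeal (vanishingIdeal Y) y ∧ 2 ≤ stalkTau J y m) :
    OrderReducible J m := by
  have hD : ∀ y ∈ (Y : Set X), (m : ℕ∞) ≤ idealOrder J y := fun y hy => (hord y hy).ge
  obtain ⟨X', π, hπ⟩ := exists_isBlowup X (vanishingIdeal Y)
  haveI : IsProper π := hπ.isProper
  haveI : IsLocallyNoetherian X' := LocallyOfFiniteType.isLocallyNoetherian π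
  refine ⟨X', π, controlledTransform π (vanishingIdeal Y) J m, IsPermissibleBlowupSeq.single Y π hreg hD hπ,
    fun x' => ?_⟩
  by_cases hmem : π x' ∈ ((vanishingIdeal Y).support : Set X)
  · rw [Scheme.IdealSheafData.coe_support_vanishingIdeal] at hmem
    exact IsBlowup.idealOrder_lt_of_curve_closedPoints hX J hm Y hreg hord hcurve hπ hmem
  · rw [hπ.idealOrder_controlledTransform_of_not_mem J m hmem]
    by_contra hge
    rw [not_lt] at hge
    apply hmem
    rw [Scheme.IdealSheafData.coe_support_vanishingIdeal]
    exact hJY _ hge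

/-- **THE CURVE SLICE RELATIVE TO AN OPEN, CLOSED-POINT FORM**: with `Y ⊆ X` as above carrying every point of order `≥ m`
INSIDE the open `V`, `(V, J|_V, m)` is order-reducible (for patching with isolated points, cf. p517124).
[cite: CossartPiltant2008, Lemma 4.3 (2)] -/
theorem orderReducible_comap_of_curve_two_le_tau_closedPoints [IsLocallyNoetherian X] [CompactSpace X]
    (hX : Scheme.IsRegular X) (J : X.IdealSheafData) {m : ℕ} (hm : 1 ≤ m) (V : X.Opens) (Y : Closeds X)
    (hreg : Scheme.IsRegular (vanishingIdeal Y).subscheme)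
    (hJY : ∀ x : X, (m : ℕ∞) ≤ idealOrder J x → x ∈ (Y : Set X) ∨ x ∉ (V : Set X))
    (hord : ∀ y ∈ (Y : Set X), idealOrder J y = m)
    (hcurve : ∀ y ∈ (Y : Set X), IsClosed ({y} : Set X) → haveI := hX y; ∃ c : Fin 2 → X.presheaf.stalk y,
      IsRsopPart c ∧ Ideal.span (Set.range c) = stalkIdeal (vanishingIdeal Y) y ∧ 2 ≤ stalkTau J y m) :
    OrderReducible (J.comap V.ι) m := by
  have hD : ∀ y ∈ (Y : Set X), (m : ℕ∞) ≤ idealOrder J y := fun y hy => (hord y hy).ge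
  obtain ⟨X', π, hπ⟩ := exists_isBlowup X (vanishingIdeal Y)
  haveI : IsProper π := hπ.isProper
  haveI : IsLocallyNoetherian X' := LocallyOfFiniteType.isLocallyNoetherian π
  refine OrderReducible.comap_opens_of_seq (IsPermissibleBlowupSeq.single Y π hreg hD hπ) V fun x' hx' => ?_
  by_cases hmem : π x' ∈ ((vanishingIdeal Y).support : Set X)
  · exfalso
    rw [Scheme.IdealSheafData.coe_support_vanishingIdeal] at hmem
    exact absurd hx' (not_le.mpr (IsBlowup.idealOrder_lt_of_curve_closedPoints hX J hm Y hreg hord hcurve hπ hmem))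
  · rw [hπ.idealOrder_controlledTransform_of_not_mem J m hmem] at hx'
    rcases hJY _ hx' with h | h
    · exfalso
      apply hmem
      rw [Scheme.IdealSheafData.coe_support_vanishingIdeal]
      exact h
    · exact h

end CampaignW46

end Summit.ResolutionOfSingularities.ResolutionOfSingularities.Theorems

end
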